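import Summits.BirchSwinnertonDyer.Rank1Residual.WAll.TargetAdditive
import HarnessLib
import HarnessLib.Audit.Tags

/-!
# Rung W-ALL of ladder BSD (D-0120) — PRIME AND RANK SLICES of rows 2, 7, 12i of the closed list
# (cell `bsd-wall`, lane (2), seat `bsd-wall-ty-1`; new small file importing `WAll.Target[Additive]`)

HONEST FRAMING (cell `bsd-wall`, run/shared/lean/pub/bsd-wall/; brief `WALL-BRIEF-v1.md` sha16
b966bf16da27706e §2; WALL-TABLE.md v1.4 rows 2 / 7 / 12): STATEMENTS AND BOOKKEEPING ONLY — nothing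
asserted, nothing booked, no named fact, no published theorem restated; every `@[conjecture] def`
below is an OPEN obligation and a SLICE of an already-registered row `Prop` of
`Rank1Residual/WAll/Target.lean` (`WAllExclAdditive`, `WAllCornerX7`, `WAllCornerFInertBad`).

WHY NAMED SLICES. The census of record (CENSUS-EXCLUSIONS-v1.1, register A2 ROUND 494) reads the
residue by ROW × RANK × PRIME, and `p = 3` is where it sits (row 2 at `3` is the largest block);
the lane-3 routes born 2026-08-27 cut their rows at exactly that granularity — their RESIDUAL items
are the `p = 3` slice of row 7 (route `SignedBaseChange`, item `CornerX7AtThree`), the `p = 3` item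
of row 12i (route `BiquadraticEisensteinDescent`, shared item 19225 `InertBadAtThree`), and the
`p = 3` / rank-`0` `p ≥ 5` / off-`♯` rank-`1` `p ≥ 5` slices of row 2 (route `AdditiveKolyvaginRoad`,
items `AdditiveAtThree`, `RankZeroAdditive`, `OffSharpRankOneAdditive`) — and seat `bsd-wall-ty-2`
closed those shapes BY NAME from the registered leaves, as HYPOTHESES of
`Rank1Residual.WAll.wallExclAdditive_of_three_of_fiveLe`, `…wallCornerX7_of_three_of_fiveLe`,
`…wallCornerFInertBad_of_fiveLe_of_inertBadAtThree` (`WAll/AltClosersAdditiveCells.lean` §3–§4,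
`WAll/AltClosersResidualCells.lean` §2–§3). Route items live in `Theses/` namespaces (not importable
here, D-0019); a closed-rung LEAF must be a Theses-free `Prop`. This file gives the slices NAMES —
shapes VERBATIM those hypothesis shapes (so the landed closers consume the names by `rfl`) — and
PROVES that each row is EXACTLY the conjunction of its slices (an odd prime is `3` or `≥ 5`,
`Nat.Prime.five_le_of_ne_two_of_ne_three`; `r ≤ 1 ↔ r = 0 ∨ r = 1`), so that a route may
`--closes-target` a slice and the kernel still tracks the row.

NOT RESTATED (slices that already exist BY NAME in the tree, to be cited instead): row 3 at `p = 3`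
/ `p ≥ 5` = rung-K2 leaves `X11b.MultiplicativeRankOneAtThree` / `X11b.MultiplicativeRankOne`
(`Rank1Residual.WAll.wallExclX11b_of_rungK2`); row 11 at `p = 3` = `X11a.TargetThree` (with
`X11a.TargetLeaf`, `…wallCornerX11a_of_targetThree_of_targetLeaf`); row 4 by rank =
`X1.RankZero.Statement` / `X1.RankOne.Statement` (`…wallCornerX1_iff_x1Statements`); row 2 by
census CELL = `WAll/TargetAdditive.lean` (`wAllExclAdditive_iff_cells`; the wild cell O6 is a
sub-slice of row 2 at `3`, `wAllExclAddWild_of_atThree` below). Rows 1, 8, 10 are single-prime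
(`2`, `3`, `3`); row 9 is `p ≥ 5` by definition.

| row | slice `Prop` (this file) | shape (binder order as consumed by the landed closers) |
|---|---|---|
| 2 @3 | `WAllExclAdditiveAtThree` | `¬CM → Addv W 3 → r ≤ 1 → BSDp W 3` (= item `AdditiveAtThree` of AKR, verbatim) |
| 2 @3, r0 / r1 | `WAllExclAdditiveAtThreeRankZero` / `…RankOne` | `¬CM → Addv W 3 → r = 0 → BSDp W 3` / `r = 1` |
| 2 @≥5 | `WAllExclAdditiveFiveLe` | `¬CM → 5 ≤ p → Addv W p → r ≤ 1 → BSDp W p` |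
| 2 @≥5, r0 / r1 | `WAllExclAdditiveFiveLeRankZero` / `…RankOne` | `¬CM → 5 ≤ p → Addv → r = 0 → BSDp` (= item `RankZeroAdditive`, verbatim) / `r = 1` |
| 7 @3 / @≥5 | `WAllCornerX7AtThree` / `WAllCornerX7FiveLe` | `p = 3 → ¬CM → ClassX7 → r ≤ 1 → BSDp` (= item `CornerX7AtThree` of SBC, verbatim) / `5 ≤ p → …` |
| 12i @3 / @≥5 | `WAllCornerFInertBadAtThree` / `WAllCornerFInertBadFiveLe` | `p = 3 → CM → r = 1 → CMInert → ¬Good → BSDp` / `5 ≤ p → …` (BSD(E,p) currency; item 19225 is the `MissingInputAt`-currency `p = 3` statement, bridged by `…cornerFInertBad_three_of_inertBadAtThree`) |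

References: `WAll/Target.lean`, `WAll/TargetAdditive.lean`, `WAll/Conjunction.lean` (the closed
list and its kernel); `WAll/AltClosersAdditiveCells.lean` §3–§4 and `WAll/AltClosersResidualCells.lean`
§2–§3 (the closers that consume these shapes); WALL-BRIEF-v1.md §2; [cite: Miller2011LMS, §1 and
Def. 1.1] (the currency `BSD(E,p)`).
-/

noncomputable section

open scoped Classical

open WeierstrassCurve Literature.NumberTheory.EllipticCurves
  Literature.NumberTheory.EllipticCurves.Rank1Residual Literature.NumberTheory.EllipticCurves.ModularForms
open Summit.BirchSwinnertonDyer.Rank1Residual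

set_option autoImplicit false

namespace Summit.BirchSwinnertonDyer

/-! ### §1. Row 2 (non-CM, odd additive `p`, `r ≤ 1`) sliced by prime `3 | ≥ 5` and rank `0 | 1` -/

/-- **Row 2 at `p = 3` (OPEN).** Non-CM `E/ℚ` (globally minimal `W`), additive at `3`, `r ≤ 1` ⇒
`BSD(E,3)`. All four census cells occur at `3` ((M), (G-ord) with `e = 2`, tame and wild
potentially supersingular); the shape is the `AdditiveKolyvaginRoad` route's residual item
`AdditiveAtThree`, verbatim. [folklore] -/
@[conjecture] def WAllExclAdditiveAtThree : Prop :=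
  ∀ (W : WeierstrassCurve ℚ) [W.IsElliptic] [W.IsGloballyMinimal],
    ¬ W.HasCM → Addv W 3 → W.analyticRank ≤ 1 → BSDp W 3

/-- Row 2 at `p = 3`, rank `0` (OPEN): non-CM, additive at `3`, `ord_{s=1} L(E,s) = 0` ⇒ `BSD(E,3)`.
[folklore] -/
@[conjecture] def WAllExclAdditiveAtThreeRankZero : Prop :=
  ∀ (W : WeierstrassCurve ℚ) [W.IsElliptic] [W.IsGloballyMinimal],
    ¬ W.HasCM → Addv W 3 → W.analyticRank = 0 → BSDp W 3

/-- Row 2 at `p = 3`, rank `1` (OPEN): non-CM, additive at `3`, `ord_{s=1} L(E,s) = 1` ⇒ `BSD(E,3)`.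
[folklore] -/
@[conjecture] def WAllExclAdditiveAtThreeRankOne : Prop :=
  ∀ (W : WeierstrassCurve ℚ) [W.IsElliptic] [W.IsGloballyMinimal],
    ¬ W.HasCM → Addv W 3 → W.analyticRank = 1 → BSDp W 3

/-- **Row 2 at `p ≥ 5` (OPEN).** Non-CM, `5 ≤ p`, additive at `p`, `r ≤ 1` ⇒ `BSD(E,p)` (three
census cells: (M), (G-ord), tame potentially supersingular — the wild cell forces `p = 3`). [folklore] -/
@[conjecture] def WAllExclAdditiveFiveLe : Prop :=
  ∀ (W : WeierstrassCurve ℚ) [W.IsElliptic] [W.IsGloballyMinimal] (p : ℕ) [Fact p.Prime],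
    ¬ W.HasCM → 5 ≤ p → Addv W p → W.analyticRank ≤ 1 → BSDp W p

/-- Row 2 at `p ≥ 5`, rank `0` (OPEN): non-CM, `5 ≤ p` additive, `ord_{s=1} L(E,s) = 0` ⇒
`BSD(E,p)`; the shape is the `AdditiveKolyvaginRoad` route's residual item `RankZeroAdditive`,
verbatim. [folklore] -/
@[conjecture] def WAllExclAdditiveFiveLeRankZero : Prop :=
  ∀ (W : WeierstrassCurve ℚ) [W.IsElliptic] [W.IsGloballyMinimal] (p : ℕ) [Fact p.Prime],
    ¬ W.HasCM → 5 ≤ p → Addv W p → W.analyticRank = 0 → BSDp W p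

/-- Row 2 at `p ≥ 5`, rank `1` (OPEN): non-CM, `5 ≤ p` additive, `ord_{s=1} L(E,s) = 1` ⇒
`BSD(E,p)` (the `AdditiveKolyvaginRoad` route attacks its `♯` sub-slice; its off-`♯` residual
`OffSharpRankOneAdditive` is this shape with one more hypothesis). [folklore] -/
@[conjecture] def WAllExclAdditiveFiveLeRankOne : Prop :=
  ∀ (W : WeierstrassCurve ℚ) [W.IsElliptic] [W.IsGloballyMinimal] (p : ℕ) [Fact p.Prime],
    ¬ W.HasCM → 5 ≤ p → Addv W p → W.analyticRank = 1 → BSDp W p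

/-! ### §2. Row 7 (corner X7: non-CM, odd good supersingular `p`, `E` not semistable) by prime -/

/-- **Row 7 at `p = 3` (OPEN).** `p = 3`, non-CM, `ClassX7 W p` (good supersingular at `p`, `E`
not semistable), `r ≤ 1` ⇒ `BSD(E,p)`; the shape is the `SignedBaseChange` route's residual item
`CornerX7AtThree`, verbatim. [folklore] -/
@[conjecture] def WAllCornerX7AtThree : Prop :=
  ∀ (W : WeierstrassCurve ℚ) [W.IsElliptic] [W.IsGloballyMinimal] (p : ℕ) [Fact p.Prime],
    p = 3 → ¬ W.HasCM → ClassX7 W p → W.analyticRank ≤ 1 → BSDp W p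

/-- **Row 7 at `p ≥ 5` (OPEN).** `5 ≤ p`, non-CM, `ClassX7 W p`, `r ≤ 1` ⇒ `BSD(E,p)` (then
`a_p = 0` by Hasse). [folklore] -/
@[conjecture] def WAllCornerX7FiveLe : Prop :=
  ∀ (W : WeierstrassCurve ℚ) [W.IsElliptic] [W.IsGloballyMinimal] (p : ℕ) [Fact p.Prime],
    5 ≤ p → ¬ W.HasCM → ClassX7 W p → W.analyticRank ≤ 1 → BSDp W p

/-! ### §3. Row 12i (CM, `r = 1`, odd `p` inert in the CM field and bad) by prime -/

/-- **Row 12i at `p = 3` (OPEN), in `BSD(E,p)` currency.** `p = 3`, CM, `ord_{s=1} L(E,s) = 1`, `3`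
inert in the CM field and of bad reduction ⇒ `BSD(E,3)`. (Item 19225 `InertBadAtThree` of routes
`InertBadSignedBranches` / `BiquadraticEisensteinDescent` is the same cell in the typed
`X12.MissingInputAt` currency; `Rank1Residual.WAll.cornerFInertBad_three_of_inertBadAtThree` turns it
into this shape granted Li–Liu–Tian 2024 and GZK.) [folklore] -/
@[conjecture] def WAllCornerFInertBadAtThree : Prop :=
  ∀ (W : WeierstrassCurve ℚ) [W.IsElliptic] [W.IsGloballyMinimal] (p : ℕ) [Fact p.Prime],
    p = 3 → W.HasCM → W.analyticRank = 1 → CMInert W p → ¬ Good W p → BSDp W p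

/-- **Row 12i at `p ≥ 5` (OPEN).** `5 ≤ p`, CM, `ord_{s=1} L(E,s) = 1`, `p` inert in the CM field
and of bad reduction ⇒ `BSD(E,p)` (where the `BiquadraticEisensteinDescent` route's deciding crux
lives). [folklore] -/
@[conjecture] def WAllCornerFInertBadFiveLe : Prop :=
  ∀ (W : WeierstrassCurve ℚ) [W.IsElliptic] [W.IsGloballyMinimal] (p : ℕ) [Fact p.Prime],
    5 ≤ p → W.HasCM → W.analyticRank = 1 → CMInert W p → ¬ Good W p → BSDp W p

/-! ### §4. Glue: each row is EXACTLY the conjunction of its slices (no mathematics) -/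

/-- Row 2 at `3` ⟺ its two rank slices (`r ≤ 1 ↔ r = 0 ∨ r = 1`). [folklore] -/
theorem wAllExclAdditiveAtThree_iff_ranks :
    WAllExclAdditiveAtThree ↔ WAllExclAdditiveAtThreeRankZero ∧ WAllExclAdditiveAtThreeRankOne := by
  constructor
  · intro h
    exact ⟨fun W _ _ hcm hadd hr ↦ h W hcm hadd (by omega),
      fun W _ _ hcm hadd hr ↦ h W hcm hadd (by omega)⟩
  · rintro ⟨h0, h1⟩ W _ _ hcm hadd hr
    rcases Nat.le_one_iff_eq_zero_or_eq_one.mp hr with h | h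
    · exact h0 W hcm hadd h
    · exact h1 W hcm hadd h

/-- Row 2 at `p ≥ 5` ⟺ its two rank slices. [folklore] -/
theorem wAllExclAdditiveFiveLe_iff_ranks :
    WAllExclAdditiveFiveLe ↔ WAllExclAdditiveFiveLeRankZero ∧ WAllExclAdditiveFiveLeRankOne := by
  constructor
  · intro h
    exact ⟨fun W _ _ p _ hcm hp5 hadd hr ↦ h W p hcm hp5 hadd (by omega),
      fun W _ _ p _ hcm hp5 hadd hr ↦ h W p hcm hp5 hadd (by omega)⟩
  · rintro ⟨h0, h1⟩ W _ _ p _ hcm hp5 hadd hr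
    rcases Nat.le_one_iff_eq_zero_or_eq_one.mp hr with h | h
    · exact h0 W p hcm hp5 hadd h
    · exact h1 W p hcm hp5 hadd h

/-- **Row 2 ⟺ its `p = 3` slice ∧ its `p ≥ 5` slice** (an odd prime is `3` or `≥ 5`). The `←`
direction is `Rank1Residual.WAll.wallExclAdditive_of_three_of_fiveLe` (`AltClosersAdditiveCells.lean`),
reproved here to keep this statement file light. [folklore] -/
theorem wAllExclAdditive_iff_three_fiveLe :
    WAllExclAdditive ↔ WAllExclAdditiveAtThree ∧ WAllExclAdditiveFiveLe := by
  constructor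
  · intro h
    exact ⟨fun W _ _ hcm hadd hr ↦ h W 3 hcm (by decide) hadd hr,
      fun W _ _ p _ hcm hp5 hadd hr ↦ h W p hcm (by omega) hadd hr⟩
  · rintro ⟨h3, h5⟩ W _ _ p _ hcm hp2 hadd hr
    by_cases hp3 : p = 3
    · subst hp3
      exact h3 W hcm hadd hr
    · exact h5 W p hcm ((Fact.out : p.Prime).five_le_of_ne_two_of_ne_three hp2 hp3) hadd hr

/-- **Row 2 ⟺ its four rank × prime slices.** [folklore] -/
theorem wAllExclAdditive_iff_primeRankSlices :
    WAllExclAdditive ↔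
      WAllExclAdditiveAtThreeRankZero ∧ WAllExclAdditiveAtThreeRankOne ∧
        WAllExclAdditiveFiveLeRankZero ∧ WAllExclAdditiveFiveLeRankOne := by
  rw [wAllExclAdditive_iff_three_fiveLe, wAllExclAdditiveAtThree_iff_ranks,
    wAllExclAdditiveFiveLe_iff_ranks, and_assoc]

/-- The wild cell O6 of row 2 (`WAllExclAddWild`, `TargetAdditive.lean`) is a sub-slice of row 2
at `3` (`Additive.ClassO6` forces `p = 3` and is additive). [folklore] -/
theorem wAllExclAddWild_of_atThree (h : WAllExclAdditiveAtThree) : WAllExclAddWild := by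
  intro W _ _ p _ hcm hO hr
  obtain rfl := Additive.ClassO6.p_eq_three hO
  exact h W hcm hO.2.1 hr

/-- **Row 7 ⟺ its `p = 3` slice ∧ its `p ≥ 5` slice.** The `←` direction is
`Rank1Residual.WAll.wallCornerX7_of_three_of_fiveLe` (`AltClosersAdditiveCells.lean`). [folklore] -/
theorem wAllCornerX7_iff_three_fiveLe :
    WAllCornerX7 ↔ WAllCornerX7AtThree ∧ WAllCornerX7FiveLe := by
  constructor
  · intro h
    exact ⟨fun W _ _ p _ hp3 hcm hX hr ↦ h W p hcm (by omega) hX hr,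
      fun W _ _ p _ hp5 hcm hX hr ↦ h W p hcm (by omega) hX hr⟩
  · rintro ⟨h3, h5⟩ W _ _ p _ hcm hp2 hX hr
    by_cases hp3 : p = 3
    · exact h3 W p hp3 hcm hX hr
    · exact h5 W p ((Fact.out : p.Prime).five_le_of_ne_two_of_ne_three hp2 hp3) hcm hX hr

/-- `WAllCornerX7AtThree` is a statement about `BSD(E,3)` (the `p = 3` instance). [folklore] -/
theorem wAllCornerX7AtThree_iff_three :
    WAllCornerX7AtThree ↔
      ∀ (W : WeierstrassCurve ℚ) [W.IsElliptic] [W.IsGloballyMinimal],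
        ¬ W.HasCM → ClassX7 W 3 → W.analyticRank ≤ 1 → BSDp W 3 := by
  constructor
  · intro h W _ _ hcm hX hr
    exact h W 3 rfl hcm hX hr
  · intro h W _ _ p _ hp3 hcm hX hr
    subst hp3
    exact h W hcm hX hr

/-- **Row 12i ⟺ its `p = 3` slice ∧ its `p ≥ 5` slice.** (Cf.
`Rank1Residual.WAll.wallCornerFInertBad_of_fiveLe_of_inertBadAtThree` /
`…slices_of_wallCornerFInertBad`, which state the `p = 3` side in `X12.MissingInputAt` currency
modulo Li–Liu–Tian 2024 and GZK; here both sides are in `BSD(E,p)` currency and the equivalence is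
unconditional.) [folklore] -/
theorem wAllCornerFInertBad_iff_three_fiveLe :
    WAllCornerFInertBad ↔ WAllCornerFInertBadAtThree ∧ WAllCornerFInertBadFiveLe := by
  constructor
  · intro h
    exact ⟨fun W _ _ p _ hp3 hcm hr1 hin hng ↦ h W p hcm hr1 (by omega) hin hng,
      fun W _ _ p _ hp5 hcm hr1 hin hng ↦ h W p hcm hr1 (by omega) hin hng⟩
  · rintro ⟨h3, h5⟩ W _ _ p _ hcm hr1 hp2 hin hng
    by_cases hp3 : p = 3
    · exact h3 W p hp3 hcm hr1 hin hng
    · exact h5 W p ((Fact.out : p.Prime).five_le_of_ne_two_of_ne_three hp2 hp3) hcm hr1 hin hng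

/-- `WAllCornerFInertBadAtThree` is a statement about `BSD(E,3)` (the `p = 3` instance). [folklore] -/
theorem wAllCornerFInertBadAtThree_iff_three :
    WAllCornerFInertBadAtThree ↔
      ∀ (W : WeierstrassCurve ℚ) [W.IsElliptic] [W.IsGloballyMinimal],
        W.HasCM → W.analyticRank = 1 → CMInert W 3 → ¬ Good W 3 → BSDp W 3 := by
  constructor
  · intro h W _ _ hcm hr1 hin hng
    exact h W 3 rfl hcm hr1 hin hng
  · intro h W _ _ p _ hp3 hcm hr1 hin hng
    subst hp3
    exact h W hcm hr1 hin hng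

/-! ### §5. Every slice follows from `WAll` (so registering slices loses and adds nothing) -/

/-- The ten slices of this file from `WAll` (each is an instance of it). [folklore] -/
theorem primeSlices_of_wAll (h : WAll) :
    (WAllExclAdditiveAtThree ∧ WAllExclAdditiveAtThreeRankZero ∧ WAllExclAdditiveAtThreeRankOne ∧
      WAllExclAdditiveFiveLe ∧ WAllExclAdditiveFiveLeRankZero ∧ WAllExclAdditiveFiveLeRankOne) ∧
    (WAllCornerX7AtThree ∧ WAllCornerX7FiveLe) ∧
    (WAllCornerFInertBadAtThree ∧ WAllCornerFInertBadFiveLe) :=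
  ⟨⟨fun W _ _ _ _ hr ↦ h W 3 hr, fun W _ _ _ _ hr ↦ h W 3 (by omega), fun W _ _ _ _ hr ↦ h W 3 (by omega),
      fun W _ _ p _ _ _ _ hr ↦ h W p hr, fun W _ _ p _ _ _ _ hr ↦ h W p (by omega),
      fun W _ _ p _ _ _ _ hr ↦ h W p (by omega)⟩,
    ⟨fun W _ _ p _ _ _ _ hr ↦ h W p hr, fun W _ _ p _ _ _ _ hr ↦ h W p hr⟩,
    ⟨fun W _ _ p _ _ _ hr1 _ _ ↦ h W p (by omega), fun W _ _ p _ _ _ hr1 _ _ ↦ h W p (by omega)⟩⟩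

/-- Conversely the slices reassemble rows 2, 7 and 12i of the closed list (bookkeeping summary of §4).
[folklore] -/
theorem rows_of_primeSlices
    (h30 : WAllExclAdditiveAtThreeRankZero) (h31 : WAllExclAdditiveAtThreeRankOne)
    (h50 : WAllExclAdditiveFiveLeRankZero) (h51 : WAllExclAdditiveFiveLeRankOne)
    (h73 : WAllCornerX7AtThree) (h75 : WAllCornerX7FiveLe)
    (hF3 : WAllCornerFInertBadAtThree) (hF5 : WAllCornerFInertBadFiveLe) :
    WAllExclAdditive ∧ WAllCornerX7 ∧ WAllCornerFInertBad :=
  ⟨wAllExclAdditive_iff_primeRankSlices.mpr ⟨h30, h31, h50, h51⟩,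
    wAllCornerX7_iff_three_fiveLe.mpr ⟨h73, h75⟩, wAllCornerFInertBad_iff_three_fiveLe.mpr ⟨hF3, hF5⟩⟩

end Summit.BirchSwinnertonDyer

end
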